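import Mathlib
import HarnessLib
import HarnessLib.Audit
import Summits.Schanuel.Statement

/-!
Route: GelfondTowers

CLOSED (retired) 2026-08-15T13:51:06Z by operator:999:1257524 — reason: not-a-thesis: assembly does not conclude the sub-problem Statement — note: D-0027 §2.1 audit (human 2026-08-15: routes that do not decide the summit are removed): the assembly concludes `GelfondRealTowers`, not the sub-problem statement; a NEW conforming route may be opened from the same idea (generated `closes : … → _root_.Schanuel`).. The file is kept as the record of this route; refuted decls are indexed as negative knowledge (`ledger negatives`).

# Route GelfondTowers — Gelfond's 1934 power-tower conjecture for real algebraic bases — the √2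
cell, the transcendental step, and the unconditional density-1/3 window below it

FRAGMENT route (target strictly below the summit, like StokesConstantPi / ClusterRankDrop; Schanuel
⟹ X is the support item
SchanuelImpliesTowers, X ⇏ Schanuel). It suffices to show X = GelfondRealTowers, the real-base
α-part of GELFOND'S 1934 POWER-TOWER
CONJECTURE in transcendence form (MarquesSondow2012 p. 3, quoting Gelfond, C. R. 199 (1934) 259):
for every real algebraic irrational
x > 0 and every k ≥ 2 the tower ^k x := x^(x^(⋰^x)) (k copies; Lean `(fun y => x ^ y)^[k] 1`) is
transcendental. k = 2 is Gelfond–Schneider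
(Hilbert's seventh problem, √2^√2); k = 3 for x = √2, i.e. √2^(√2^√2) = 1.7608…, is the first open
cell (crux Sqrt2TowerThree). X is
assembled from the first cell for all bases (ThirdTowerAllBases) and the TRANSCENDENTAL STEP (^k x ∉
ℚ̄ ⟹ ^(k+1) x ∉ ℚ̄, TranscendentalStep)
by induction; below X the route files the UNCONDITIONAL ladder found while costing the card's Kœnigs
mechanism: Gelfond–Schneider alone
gives "one of any three consecutive towers of √2 is transcendental" (support BasinOrbitWindow,
stated for every orbit of y ↦ √2^y in the
basin of the fixed point 2), "one of any two" is EQUIVALENT to irrationality of all towers (crux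
Sqrt2TowersIrrational + support
TowerWindowTwoIffIrrational), and six exponentials gives the card's disjunction
(SixExpTowerDisjunction). Realises card gelfond-power-towers-koenigs.
Lean: `∀ x : ℝ, 0 < x → IsAlgebraic ℚ x → Irrational x → ∀ k : ℕ, 2 ≤ k → Transcendental ℚ ((fun y :
ℝ => x ^ y)^[k] 1)`

## Assembly
Induction on k (sorry-free in the planner's Sketch.lean, `assembly_holds`, axioms
propext/Classical.choice/Quot.sound): unfold
`(fun y => x ^ y)^[k] 1` with `Function.iterate_succ` and `Real.rpow_one`; k = 2 is
RealGelfondSchneider at (x, x) (x ≠ 1 because x is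
irrational); k = 3 is ThirdTowerAllBases; k ≥ 3 → k + 1 is TranscendentalStep. The target is the
route's own decl GelfondRealTowers (fragment
route: the summit implies it via SchanuelImpliesTowers, not conversely).

Rationale: WHY THIS LINE. Gelfond announced in 1934, with a proof that never appeared, that all towers
α^(α^(⋰^α)) of an algebraic irrational α are transcendental
(and algebraically independent); MarquesSondow2012 (arXiv:1212.6931, Thm 1) derive it from Schanuel,
SondowMarques2010 (arXiv:1108.6096,
App.) and KobayashiSaitoTakeda2023 (arXiv:1912.09125) settle the INFINITE tower h(x) (x^h = h, so
Gelfond–Schneider forces h ∈ ℚ ∪ 𝕋 —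
our support FixedPointDichotomy), and nothing unconditional about a finite tower of height ≥ 3 is in
print. The mechanism imported from
one-dimensional dynamics (card: Kœnigs linearisation of g(y) = x^y at the attracting fixed point y*
= h(x), multiplier λ = log h(x); for
x = √2: y* = 2, λ = log 2, ^k√2 = Ψ(λ^(k+1)·w₀) with w₀ = Φ(0) = −0.91192589…, regular tetration in
the sense of KouznetsovTrappmann2010)
is COSTED here: along any g-orbit, Gelfond–Schneider maps algebraic-irrational points to
transcendental ones and rational points r to
algebraic ones 2^(r/2), so m+1 consecutive algebraic orbit points force m consecutive RATIONAL ones,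
and in the basin (0,4) of 2 a rational
r with 2^(r/2) rational is r = 2 — hence the card's "first provable shadow of C2" (no orbit other
than the fixed point is eventually
algebraic) is a theorem of Gelfond–Schneider strength (BasinOrbitWindow, density ≥ 1/3 of
transcendental towers), density ≥ 1/2 is
exactly the irrationality of the towers, and density 1 is X: the functional equation Ψ(λw) = √2^Ψ(w)
buys the chain and nothing more,
which is the honest answer to the triage's demand. Imported areas: transcendence (Gelfond–Schneider
= tree `gelfond_schneider_holds`,
six exponentials = tree `six_exponentials_holds`, both PROVED, so every support item is provable
now), real one-dimensional dynamics
(orbits/basin of y ↦ √2^y, Kœnigs asymptotics TowerAsymptotics); no prior route or negative (index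
empty) touches towers.

RANKED CRUXES. #0 GelfondRealTowers (target) — Gelfond's power-tower conjecture, real algebraic
irrational base x > 0, transcendence form: ^k x is transcendental for every k ≥ 2 (k = 2 known by
Gelfond–Schneider; open from k = 3). (why it might fail: only Schanuel implies it (MarquesSondow2012
Thm 1); from k = 3 the exponent ^(k−1) x is transcendental, outside Gelfond–Schneider/Baker/six
exponentials; false iff some tower equals log_x of an algebraic number.) [MarquesSondow2012,
arXiv:1212.6931, Gelfond1934, Waldschmidt2000]
#2 Sqrt2TowerThree (crux) — the first open cell of Gelfond's conjecture ("the other bracketing" of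
the classroom √2^√2 example): √2^(√2^√2) = 2^(2^(1/√2)/2) = 1.76083955588… is transcendental (card
C1). [difficulty: open-problem] (why it might fail: exponent √2^√2 is transcendental (GS), so no
theorem applies; algebraic iff 2^(1/√2) ∈ 2·log₂(ℚ̄), a three-term exp relation no
linear-subgroup/Baker format excludes (Roy no-go: rank-one 2×2 block); SC-only in print.)
[MarquesSondow2012, arXiv:1212.6931, SondowMarques2010, Waldschmidt2000]
#3 TranscendentalStep (crux) — the inductive step of Gelfond's conjecture for real algebraic
irrational bases: for k ≥ 3, if ^k x is transcendental then so is ^(k+1) x = x^(^k x) ("x^t for the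
transcendental tower values t"; with ThirdTowerAllBases and Gelfond–Schneider it assembles X by
induction). [deps: ThirdTowerAllBases] [difficulty: open-problem] (why it might fail: fails iff some
transcendental tower ^k x equals log β / log x with β algebraic — the T with α^T ∈ ℚ̄ phenomenon of
SondowMarques2010 §2 (√2^(2 log₂3) = 3); nothing unconditional separates towers from such ratios of
logarithms.) [SondowMarques2010, arXiv:1108.6096, MarquesSondow2012, BakerTNT1975]
#4 ThirdTowerAllBases (crux) — the first cell for every base: x^(x^x) is transcendental for every
real algebraic irrational x > 0 (Gelfond–Schneider with the transcendental exponent x^x;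
Sqrt2TowerThree is its instance x = √2). [difficulty: open-problem] (why it might fail: x^(x^x)
algebraic iff x^x = log_x β (β ∈ ℚ̄): excluded by no known theorem; six exponentials only gives 'one
of x^(x^x), x^(x^(2x)), x^(x^(3x))' (support SixExpTowerDisjunction), four exponentials conj. 'one
of the first two'.) [MarquesSondow2012, arXiv:1212.6931, Lang1966, Ramachandra1968, Waldschmidt2000]
#5 Sqrt2TowersIrrational (crux) — HALF-DENSITY RUNG: no tower ^k√2 with k ≥ 3 is rational. By
TowerWindowTwoIffIrrational this is EQUIVALENT to "of any two consecutive towers ^k√2, ^(k+1)√2 (k ≥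
3) one is transcendental", doubling the unconditional density 1/3 of BasinOrbitWindow; strictly
weaker than X at every k. [difficulty: open-problem] (why it might fail: even irrationality of ^3√2
looks open: ^3√2 = p/q iff log(p/q) = (log 2/2)·2^(1/√2), and for k ≥ 4 the exponent is not even
known transcendental; no irrationality engine (no series/continued fraction for towers) is known.)
[SondowMarques2010, arXiv:1108.6096, MarquesSondow2012, KobayashiSaitoTakeda2023]
#9 RealGelfondSchneider (support) — real Gelfond–Schneider: for real algebraic x > 0, x ≠ 1 and real
algebraic irrational y, x^y (Real.rpow) is transcendental — bookkeeping from the tree's PROVED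
`Literature.NumberTheory.Transcendental.gelfond_schneider_holds` (x^y = exp(y·log x), log x ≠ 0);
gives k = 2 of X (Hilbert's √2^√2) and drives every chain argument below. [difficulty: provable-now]
[Gelfond1934, BakerTNT1975, Literature.NumberTheory.Transcendental.gelfond_schneider_holds]
#9 BasinOrbitWindow (support) — UNCONDITIONAL DENSITY 1/3 (new here; costs the card's Kœnigs crux
C2): for every real y₀ < 4 with y₀ ≠ 2 and every n ≥ 1, one of g^n(y₀), g^(n+1)(y₀), g^(n+2)(y₀) is
transcendental, g(y) = √2^y (towers: y₀ = 1 or 0). Proof: three consecutive algebraic points force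
g^n(y₀) = r ∈ ℚ and 2^(r/2) ∈ ℚ (RealGelfondSchneider twice), so r ∈ 2ℤ ∩ (0,4) = {2}, and g
strictly increasing with g(2) = 2 gives y₀ = 2. [difficulty: provable-now] [SondowMarques2010,
arXiv:1108.6096, Literature.NumberTheory.Transcendental.gelfond_schneider_holds]
#9 TowerWindowTwoIffIrrational (support) — the half-density rung is exactly irrationality: (no
rational tower ^k√2, k ≥ 3) ↔ (for every k ≥ 3 one of ^k√2, ^(k+1)√2 is transcendental). (→: an
algebraic irrational ^k√2 makes ^(k+1)√2 transcendental by RealGelfondSchneider; ←: a rational ^k√2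
= r makes ^(k+1)√2 = 2^(r/2) algebraic.) [difficulty: provable-now] [SondowMarques2010,
Literature.NumberTheory.Transcendental.gelfond_schneider_holds]
#9 SixExpTowerDisjunction (support) — card C1, provable now from the tree's PROVED six exponentials
theorem (`six_exponentials_holds`, rows (log x)·(1, t), columns (1, t, t²), t = x^x transcendental
by GS so both families are ℚ-free): for real algebraic irrational x > 0 at least one of x^(x^x) =
^3x, x^(x^(2x)) = x^(t²), x^(x^(3x)) = x^(t³) is transcendental (x = √2: one of 1.7608…, 2.5185…,
4.5173…). [difficulty: provable-now] [Lang1966, Ramachandra1968, Waldschmidt2000,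
Literature.NumberTheory.Transcendental.six_exponentials_holds]
#9 FixedPointDichotomy (support) — why the INFINITE tower is easy (card A; SondowMarques2010 App.,
KobayashiSaitoTakeda2023): a real solution y of x^y = y with x > 0 real algebraic is rational or
transcendental (if y were algebraic irrational, x^y would be transcendental by RealGelfondSchneider,
x ≠ 1 being forced); e.g. h(√2) = 2, h(x) ∈ 𝕋 for algebraic x ∈ [e^(−e), e^(1/e)] not of the form
(p/q)^(q/p). [difficulty: provable-now] [SondowMarques2010, arXiv:1108.6096,
KobayashiSaitoTakeda2023, arXiv:1912.09125]
#9 SchanuelImpliesTowers (support) — BELOW THE SUMMIT: Schanuel's conjecture implies X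
(MarquesSondow2012 Thm 1, Case 2, with SC in place of SSC: SC at (1, x, ^2x, …, ^(k−1)x)·log x,
ℚ-free by the induction hypothesis, gives trdeg ℚ(log x, ^2x, …, ^k x) ≥ k); records that the route
is a fragment, X ⇏ Schanuel. [difficulty: M] [MarquesSondow2012, arXiv:1212.6931, Waldschmidt2000]
#9 TowerAsymptotics (support) — the Kœnigs constant of the card as a typed real number: (2 −
^k√2)/(log 2)^k converges to some c > 0 (c = −w₀·log 2 = 0.63209886…, w₀ = Φ(0) = −0.91192589… the
Kœnigs coordinate of 0 for g(y) = √2^y at the fixed point 2 with multiplier g′(2) = log 2); proof: 2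
− ^(k+1)√2 = g′(ξ_k)(2 − ^k√2) with g′(ξ_k)/log 2 = 2^((ξ_k−2)/2) ↑ 1 geometrically, so the ratio
sequence is positive, decreasing, with positive limit. [difficulty: M] [KouznetsovTrappmann2010,
doi:10.1090/s0025-5718-10-02342-2, Milnor2006]

TWO-LAYER PLAN. Foreseen glued splits (k ≤ 3, depth 1), filed only when something closes or a
grounder asks: (i) Sqrt2TowersIrrational ⇐ Irr3 (^3√2 ∉ ℚ,
i.e. log r ≠ (log 2/2)·2^(1/√2) for r ∈ ℚ) → IrrStep (^k√2 ∉ ℚ → ^(k+1)√2 ∉ ℚ for k ≥ 3) →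
Sqrt2TowersIrrational; (ii) TranscendentalStep ⇐
(towers are never log_x of an algebraic number: ∀ k ≥ 3, ∀ β ∈ ℚ̄, ^k x · log x ≠ log β) →
(bookkeeping x^t = β ↔ t log x = log β) →
TranscendentalStep; (iii) ThirdTowerAllBases ⇐ (four exponentials conjecture
`Literature.NumberTheory.Transcendental.FourExponentialsConjecture`
→ one of x^(x^x), x^(x^(2x))) → (x^(x^(2x)) ∈ ℚ̄-exclusion) → ThirdTowerAllBases, the conditional
rung between six exponentials and the cell.

KILL CRITERIA. An integer relation certifying ^3√2 ∈ ℚ̄ (or any ^k x ∈ ℚ̄, k ≥ 3, x algebraic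
irrational) refutes Sqrt2TowerThree / ThirdTowerAllBases /
X AND Schanuel itself (SchanuelImpliesTowers) — every Schanuel route closes, this one
`refuted:Sqrt2TowerThree`. A rational tower ^k√2 = r (k ≥ 3)
refutes Sqrt2TowersIrrational and X at height k itself (an algebraic tower), hence Schanuel: same
outcome (amusingly it would also PROVE
^(k+2)√2 transcendental, ^(k+1)√2 = 2^(r/2) being algebraic irrational).
TranscendentalStep refuted alone (a transcendental tower with algebraic successor) ⇒ ¬X ⇒ ¬Schanuel.
Nothing partial kills the line short of
¬Schanuel; conversely a proof of X elsewhere (or of Schanuel) moots it — close superseded. If a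
refuter shows BasinOrbitWindow /
TowerWindowTwoIffIrrational are already in print, they stay support (provable-now) and only the
novelty grade drops.

NOT DECOMPOSED YET. The algebraic-independence form (log x, ^2x, ^3x, … algebraically independent;
MarquesSondow2012 Thm 1) and the rational non-integer
bases x ∈ ℚ∖ℤ (^3x transcendental by GS via irrationality of (p/q)^(p/q), SondowMarques2010 Lemma
2.1; open from k = 4) — both easy to
file as support/crux once X's shape is stamped; complex algebraic bases and the e-part e^(ω₁e^(ω₂…))
of Gelfond's announcement (card
exp-log-diagonal-trajectory's territory); the Brownawell–Waldschmidt co-failure edge "^3x,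
x^(x^(2x)) both algebraic ⇒ log x ⊥ x^x"
(card C3) — NOT filed because the tree's B–W clause
`Literature.Barriers.Schanuel.smallTrdeg_thm_2_9_two_two` is still an unproved named
fact (BW*.lean in progress); the general-base window theorem (bases x ≤ e^(1/e), or x ∉ ℚ^ℚ, where
rational runs have length ≤ 1) and
the classification of totally algebraic g-orbits for x = √2 (exactly y₀ ∈ 2ℤ≥1: 6 ↦ 8 ↦ 16 ↦ 256 …);
the Kœnigs function Φ itself
(existence/analyticity, Ψ ∈ ℚ(log 2)[[w]], singularities at w₀λ^(−n)) beyond the one constant in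
TowerAsymptotics; quantitative versions.

CHEAPEST FALSIFIER. PSLQ/LLL at 60 digits for an integer relation among the monomials of degree ≤ 8
in ^3√2 = 1.7608395558800285… alone (algebraicity of
degree ≤ 8, height ≤ 10¹²) and of degree ≤ 4 in (log 2, √2^√2, ^3√2, ^4√2 = 1.8409108692910108…):
any relation refutes Sqrt2TowerThree
(resp. Schanuel); and a continued-fraction scan of ^3√2, ^4√2, ^5√2 for absurdly large partial
quotients (evidence on Sqrt2TowersIrrational).
Not run here (hub compute-free); the values above were recomputed in double precision this session
(w₀ ≈ −0.91192589, c ≈ 0.63209886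
from k = 38). Lookup falsifier for novelty only: a printed "one of three consecutive towers" remark
(searched SondowMarques2010 App.,
MarquesSondow2012, zbMATH/crossref "power tower transcendental", galaxy "infinite power
tower"/"tetration" — not found).

NUMBERS. √2^√2 = 1.6325269194381528… (transcendental, GS); ^3√2 = 1.7608395558800285…; ^4√2 =
1.8409108692910108…; ^5√2 = 1.8927126968…;
^k√2 ↑ 2 with 2 − ^k√2 ~ c·(log 2)^k, c = 0.63209886…, Kœnigs constant w₀ = Φ(0) = −c/log 2 =
−0.91192589… (card, reproduced at k = 38);
Euler's interval [e^(−e), e^(1/e)] = [0.065988…, 1.444667…] ∋ √2; fixed points of y ↦ √2^y: 2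
(attracting, multiplier log 2 = 0.6931…) and
4 (repelling, multiplier 2 log 2); six-exponentials triple at x = √2: (1.76084, 2.51851, 4.51730).
Unconditional density of transcendental
towers of √2: ≥ 1/3 (BasinOrbitWindow); = 1/2-window iff Sqrt2TowersIrrational; Gelfond: all. Items
at open: 13 (1 target, 4 cruxes,
7 support, 1 assembly).

DEFINITION REQUESTS. None. Towers are written inline as `(fun y : ℝ => x ^ y)^[k] 1` (Mathlib
`Nat.iterate`, `Real.rpow`); every constant exists
(`Transcendental`, `IsAlgebraic`, `Irrational`, `Real.sqrt`, `Real.log`, `Filter.Tendsto`, root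
`Schanuel`). No cite facts needed:
Gelfond–Schneider and six exponentials are PROVED in the tree.

Novelty: Searches (2026-08-15): `lit read arxiv:1212.6931` pp. 3–5 (conjecture verbatim, Thm 1 and its proof)
and `lit read arxiv:1108.6096` pp. 7–8
(Appendix: h, h_o, h_e, Prop. 4 "both irrational, at least one transcendental", Lemma 4.4) READ;
`lit galaxy search --star all` for
"infinite power tower" (6: popular books + Toledo 2022), "tetration" (19, noise), "iterated
exponential" (16: DFT 'generic solutions of
equations with iterated exponentials', proof theory), "Gelfond's power tower" (0); `lit search
"power tower transcendental algebraic
Gelfond-Schneider"` (local: arXiv:1108.6096, arXiv:2310.06780, arXiv:1504.03263; crossref 20 incl.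
Waldschmidt 'Algebraic dynamics and
transcendental numbers' doi:10.1007/3-540-45463-2_19 — paywalled, acq-02419); zbMATH "power tower
irrational transcendental" (1, irrelevant),
"tetration transcendence" (0); `lit search --hybrid` open-problem lists (Chudnovsky1984,
NesterenkoPhilippon2001, BakerTNT1975, Baker1988 —
e-powers only); `lit vsearch` for the √2 tower (textbook non-constructive-proof pages only); card +
triage searches (zbMATH/arXiv, 2026-08-15)
inherited; OpenAlex/S2/arXiv APIs 429 today. `lean search` confirmed gelfond_schneider_holds,
six_exponentials_holds proved, B–W unproved.
Nearest prior art found: MarquesSondow2012 = arXiv:1212.6931 (the conjecture; SC ⟹ towers),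
SondowMarques2010 = arXiv:1108.6096 (infinite
towers via GS; the same chain idea for h_o/h_e at rational bases, Prop. 4), KobayashiSaitoTakeda2023
= arXiv:1912.09125 (e  [refs: 10.1007/3-540-45463-2_19, 1212.6931, 1108.6096, 2310.06780, 1504.03263, 1912.09125, arxiv:1212.6931, arxiv:1108.6096, doi:10.1007/3-540-45463-2_19, Chudnovsky1984, NesterenkoPhilippon2001, BakerTNT1975, MarquesSondow2012, SondowMarques2010, KobayashiSaitoTakeda2023, KouznetsovTrappmann2010]

Barriers (technique_class: gelfond-schneider, six-exponentials, koenigs): - technique_class: gelfond-schneider, six-exponentials, koenigs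
- Literature.Barriers.Schanuel.LinearSubgroupMethodLimit: APPLIES to every crux and is not evaded:
the configurations (log x)(1, t) × (1, t, …) with t = x^x are rank-one 2×2 blocks, so the linear
subgroup theorem yields only disjunctions (SixExpTowerDisjunction) — the route states this as the
reason its unconditional layer is disjunctive/density-type and places the cruxes explicitly above
it; the bet is only that the tower ORBIT structure (rational ↦ algebraic ↦ transcendental
propagation) is extra information no grid statement uses.
- Literature.Barriers.Schanuel.AlgebraicIndependenceOfLogarithms: not engaged by the items filed
(single logarithm log x throughout); the dropped B–W edge would touch log x ⊥ x^x, below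
AlgIndepLogs, consistent with route AlgIndepMethod.
- Literature.Barriers.Schanuel.LargeTranscendenceDegree: the independence form of Gelfond's
conjecture (trdeg k on a (1,k) line) is beyond every grid theorem; conceded — only transcendence of
single towers is targeted, independence is left in 'Not decomposed yet'.
- Literature.Barriers.Schanuel.EFunctionValuesAtAlgebraicPoints: not invoked; the Kœnigs inverse Ψ
has coefficients in ℚ(log 2) and a q-difference (Poincaré) equation, not an E-function ODE; the
analogous scope limit for Mahler/Poincaré methods (polynomial map, algebraic multiplier, algebraic
point — all three fail here) is why no Kœnigs-type crux is filed, only the constant (TowerAsymptoti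

History (route lifecycle, newest last):
- 2026-08-15T13:51:06Z · CLOSED retired — not-a-thesis: assembly does not conclude the sub-problem Statement (operator:999:1257524)

sub-problem: Schanuel · status: closed(retired) · opened planner-plancard-Schanuel-Schanuel-gelfond-po-31139e9b-0 2026-08-15T12:05:24Z · rev 1 · ledger route-Schanuel-GelfondTowers
GENERATED by the gate from the ledger (D-0016/17). Provers cite these decls: `theorem foo : Summit.Schanuel.Schanuel.Theses.GelfondTowers.<Decl> := …` in Summits/Schanuel/Schanuel/Theorems/<Name>.lean.
-/

namespace Summit.Schanuel.Schanuel.Theses.GelfondTowers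

open scoped BigOperators Topology Manifold Classical MeasureTheory ProbabilityTheory Matrix InnerProductSpace ComplexConjugate ContinuousMap
open Filter Set Function TopologicalSpace MeasureTheory

attribute [summit_statement] _root_.Schanuel

open Literature.Periods

/-- item stmt-Schanuel-7210 · target · rank 0 · closed · moot by None · by planner
why it might fail: only Schanuel implies it (MarquesSondow2012 Thm 1); from k = 3 the exponent ^(k−1) x is transcendental, outside Gelfond–Schneider/Baker/six exponentials; false iff some tower equals log_x of an algebraic number.
sources: MarquesSondow2012, arXiv:1212.6931, Gelfond1934, Waldschmidt2000
[target] Gelfond's power-tower conjecture, real algebraic irrational base x > 0, transcendence form: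
^k x is transcendental for every k ≥ 2 (k = 2 known by Gelfond–Schneider; open from k = 3). -/
@[route_item "route-Schanuel-GelfondTowers"]
def GelfondRealTowers : Prop :=
  ∀ x : ℝ, 0 < x → IsAlgebraic ℚ x → Irrational x → ∀ k : ℕ, 2 ≤ k → Transcendental ℚ ((fun y : ℝ => x ^ y)^[k] 1)

/-- item stmt-Schanuel-7211 · crux · rank 2 · closed · moot by None · by planner
why it might fail: exponent √2^√2 is transcendental (GS), so no theorem applies; algebraic iff 2^(1/√2) ∈ 2·log₂(ℚ̄), a three-term exp relation no linear-subgroup/Baker format excludes (Roy no-go: rank-one 2×2 block); SC-only in print.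
sources: MarquesSondow2012, arXiv:1212.6931, SondowMarques2010, Waldschmidt2000
[crux] the first open cell of Gelfond's conjecture ("the other bracketing" of the classroom √2^√2
example): √2^(√2^√2) = 2^(2^(1/√2)/2) = 1.76083955588… is transcendental (card C1). [difficulty:
open-problem] -/
@[route_item "route-Schanuel-GelfondTowers"]
def Sqrt2TowerThree : Prop :=
  Transcendental ℚ (Real.sqrt 2 ^ (Real.sqrt 2 ^ Real.sqrt 2))

/-- item stmt-Schanuel-7212 · crux · rank 3 · closed · moot by None · by planner
why it might fail: fails iff some transcendental tower ^k x equals log β / log x with β algebraic — the T with α^T ∈ ℚ̄ phenomenon of SondowMarques2010 §2 (√2^(2 log₂3) = 3); nothing unconditional separates towers from such ratios of logarithms.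
sources: SondowMarques2010, arXiv:1108.6096, MarquesSondow2012, BakerTNT1975
[crux] the inductive step of Gelfond's conjecture for real algebraic irrational bases: for k ≥ 3, if
^k x is transcendental then so is ^(k+1) x = x^(^k x) ("x^t for the transcendental tower values t";
with ThirdTowerAllBases and Gelfond–Schneider it assembles X by induction). [deps:
ThirdTowerAllBases] [difficulty: open-problem] -/
@[route_item "route-Schanuel-GelfondTowers"]
def TranscendentalStep : Prop :=
  ∀ x : ℝ, 0 < x → IsAlgebraic ℚ x → Irrational x → ∀ k : ℕ, 3 ≤ k → Transcendental ℚ ((fun y : ℝ => x ^ y)^[k] 1) → Transcendental ℚ ((fun y : ℝ => x ^ y)^[k + 1] 1)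

/-- item stmt-Schanuel-7213 · crux · rank 4 · closed · moot by None · by planner
why it might fail: x^(x^x) algebraic iff x^x = log_x β (β ∈ ℚ̄): excluded by no known theorem; six exponentials only gives 'one of x^(x^x), x^(x^(2x)), x^(x^(3x))' (support SixExpTowerDisjunction), four exponentials conj. 'one of the first two'.
sources: MarquesSondow2012, arXiv:1212.6931, Lang1966, Ramachandra1968, Waldschmidt2000
[crux] the first cell for every base: x^(x^x) is transcendental for every real algebraic irrational
x > 0 (Gelfond–Schneider with the transcendental exponent x^x; Sqrt2TowerThree is its instance x =
√2). [difficulty: open-problem] -/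
@[route_item "route-Schanuel-GelfondTowers"]
def ThirdTowerAllBases : Prop :=
  ∀ x : ℝ, 0 < x → IsAlgebraic ℚ x → Irrational x → Transcendental ℚ (x ^ (x ^ x))

/-- item stmt-Schanuel-7214 · crux · rank 5 · closed · moot by None · by planner
why it might fail: even irrationality of ^3√2 looks open: ^3√2 = p/q iff log(p/q) = (log 2/2)·2^(1/√2), and for k ≥ 4 the exponent is not even known transcendental; no irrationality engine (no series/continued fraction for towers) is known.
sources: SondowMarques2010, arXiv:1108.6096, MarquesSondow2012, KobayashiSaitoTakeda2023
[crux] HALF-DENSITY RUNG: no tower ^k√2 with k ≥ 3 is rational. By TowerWindowTwoIffIrrational this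
is EQUIVALENT to "of any two consecutive towers ^k√2, ^(k+1)√2 (k ≥ 3) one is transcendental",
doubling the unconditional density 1/3 of BasinOrbitWindow; strictly weaker than X at every k.
[difficulty: open-problem] -/
@[route_item "route-Schanuel-GelfondTowers"]
def Sqrt2TowersIrrational : Prop :=
  ∀ k : ℕ, 3 ≤ k → Irrational ((fun y : ℝ => Real.sqrt 2 ^ y)^[k] 1)

/-- item stmt-Schanuel-7215 · support · rank 9 · closed · moot by None · by planner
sources: Gelfond1934, BakerTNT1975, Literature.NumberTheory.Transcendental.gelfond_schneider_holds
[support] real Gelfond–Schneider: for real algebraic x > 0, x ≠ 1 and real algebraic irrational y,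
x^y (Real.rpow) is transcendental — bookkeeping from the tree's PROVED
`Literature.NumberTheory.Transcendental.gelfond_schneider_holds` (x^y = exp(y·log x), log x ≠ 0);
gives k = 2 of X (Hilbert's √2^√2) and drives every chain argument below. [difficulty: provable-now] -/
@[route_item "route-Schanuel-GelfondTowers"]
def RealGelfondSchneider : Prop :=
  ∀ x y : ℝ, 0 < x → x ≠ 1 → IsAlgebraic ℚ x → IsAlgebraic ℚ y → Irrational y → Transcendental ℚ (x ^ y)

/-- item stmt-Schanuel-7216 · support · rank 9 · closed · moot by None · by planner
sources: SondowMarques2010, arXiv:1108.6096, Literature.NumberTheory.Transcendental.gelfond_schneider_holds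
[support] UNCONDITIONAL DENSITY 1/3 (new here; costs the card's Kœnigs crux C2): for every real y₀ <
4 with y₀ ≠ 2 and every n ≥ 1, one of g^n(y₀), g^(n+1)(y₀), g^(n+2)(y₀) is transcendental, g(y) =
√2^y (towers: y₀ = 1 or 0). Proof: three consecutive algebraic points force g^n(y₀) = r ∈ ℚ and
2^(r/2) ∈ ℚ (RealGelfondSchneider twice), so r ∈ 2ℤ ∩ (0,4) = {2}, and g strictly increasing with
g(2) = 2 gives y₀ = 2. [difficulty: provable-now] -/
@[route_item "route-Schanuel-GelfondTowers"]
def BasinOrbitWindow : Prop :=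
  ∀ y₀ : ℝ, y₀ < 4 → y₀ ≠ 2 → ∀ n : ℕ, 1 ≤ n → ∃ i < 3, Transcendental ℚ ((fun y : ℝ => Real.sqrt 2 ^ y)^[n + i] y₀)

/-- item stmt-Schanuel-7217 · support · rank 9 · closed · moot by None · by planner
sources: SondowMarques2010, Literature.NumberTheory.Transcendental.gelfond_schneider_holds
[support] the half-density rung is exactly irrationality: (no rational tower ^k√2, k ≥ 3) ↔ (for
every k ≥ 3 one of ^k√2, ^(k+1)√2 is transcendental). (→: an algebraic irrational ^k√2 makes
^(k+1)√2 transcendental by RealGelfondSchneider; ←: a rational ^k√2 = r makes ^(k+1)√2 = 2^(r/2)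
algebraic.) [difficulty: provable-now] -/
@[route_item "route-Schanuel-GelfondTowers"]
def TowerWindowTwoIffIrrational : Prop :=
  (∀ k : ℕ, 3 ≤ k → Irrational ((fun y : ℝ => Real.sqrt 2 ^ y)^[k] 1)) ↔ (∀ k : ℕ, 3 ≤ k → Transcendental ℚ ((fun y : ℝ => Real.sqrt 2 ^ y)^[k] 1) ∨ Transcendental ℚ ((fun y : ℝ => Real.sqrt 2 ^ y)^[k + 1] 1))

/-- item stmt-Schanuel-7218 · support · rank 9 · closed · moot by None · by planner
sources: Lang1966, Ramachandra1968, Waldschmidt2000, Literature.NumberTheory.Transcendental.six_exponentials_holds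
[support] card C1, provable now from the tree's PROVED six exponentials theorem
(`six_exponentials_holds`, rows (log x)·(1, t), columns (1, t, t²), t = x^x transcendental by GS so
both families are ℚ-free): for real algebraic irrational x > 0 at least one of x^(x^x) = ^3x,
x^(x^(2x)) = x^(t²), x^(x^(3x)) = x^(t³) is transcendental (x = √2: one of 1.7608…, 2.5185…,
4.5173…). [difficulty: provable-now] -/
@[route_item "route-Schanuel-GelfondTowers"]
def SixExpTowerDisjunction : Prop :=
  ∀ x : ℝ, 0 < x → IsAlgebraic ℚ x → Irrational x → Transcendental ℚ (x ^ (x ^ x)) ∨ Transcendental ℚ (x ^ (x ^ (2 * x))) ∨ Transcendental ℚ (x ^ (x ^ (3 * x)))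

/-- item stmt-Schanuel-7219 · support · rank 9 · closed · moot by None · by planner
sources: SondowMarques2010, arXiv:1108.6096, KobayashiSaitoTakeda2023, arXiv:1912.09125
[support] why the INFINITE tower is easy (card A; SondowMarques2010 App., KobayashiSaitoTakeda2023):
a real solution y of x^y = y with x > 0 real algebraic is rational or transcendental (if y were
algebraic irrational, x^y would be transcendental by RealGelfondSchneider, x ≠ 1 being forced); e.g.
h(√2) = 2, h(x) ∈ 𝕋 for algebraic x ∈ [e^(−e), e^(1/e)] not of the form (p/q)^(q/p). [difficulty:
provable-now] -/
@[route_item "route-Schanuel-GelfondTowers"]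
def FixedPointDichotomy : Prop :=
  ∀ x y : ℝ, 0 < x → IsAlgebraic ℚ x → x ^ y = y → (∃ q : ℚ, (q : ℝ) = y) ∨ Transcendental ℚ y

/-- item stmt-Schanuel-7220 · support · rank 9 · closed · moot by None · by planner
sources: MarquesSondow2012, arXiv:1212.6931, Waldschmidt2000
[support] BELOW THE SUMMIT: Schanuel's conjecture implies X (MarquesSondow2012 Thm 1, Case 2, with
SC in place of SSC: SC at (1, x, ^2x, …, ^(k−1)x)·log x, ℚ-free by the induction hypothesis, gives
trdeg ℚ(log x, ^2x, …, ^k x) ≥ k); records that the route is a fragment, X ⇏ Schanuel. [difficulty: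
M] -/
@[route_item "route-Schanuel-GelfondTowers"]
def SchanuelImpliesTowers : Prop :=
  Schanuel → ∀ x : ℝ, 0 < x → IsAlgebraic ℚ x → Irrational x → ∀ k : ℕ, 2 ≤ k → Transcendental ℚ ((fun y : ℝ => x ^ y)^[k] 1)

/-- item stmt-Schanuel-7221 · support · rank 9 · closed · moot by None · by planner
sources: KouznetsovTrappmann2010, doi:10.1090/s0025-5718-10-02342-2, Milnor2006
[support] the Kœnigs constant of the card as a typed real number: (2 − ^k√2)/(log 2)^k converges to
some c > 0 (c = −w₀·log 2 = 0.63209886…, w₀ = Φ(0) = −0.91192589… the Kœnigs coordinate of 0 for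
g(y) = √2^y at the fixed point 2 with multiplier g′(2) = log 2); proof: 2 − ^(k+1)√2 = g′(ξ_k)(2 −
^k√2) with g′(ξ_k)/log 2 = 2^((ξ_k−2)/2) ↑ 1 geometrically, so the ratio sequence is positive,
decreasing, with positive limit. [difficulty: M] -/
@[route_item "route-Schanuel-GelfondTowers"]
def TowerAsymptotics : Prop :=
  ∃ c : ℝ, 0 < c ∧ Filter.Tendsto (fun k : ℕ => (2 - (fun y : ℝ => Real.sqrt 2 ^ y)^[k] 1) / Real.log 2 ^ k) Filter.atTop (nhds c)

/-- item stmt-Schanuel-7222 · assembly · rank 1 · closed · moot by None · by planner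
sources: MarquesSondow2012, Gelfond1934
[assembly] RealGelfondSchneider → ThirdTowerAllBases → TranscendentalStep → GelfondRealTowers
(induction on the height k). -/
@[route_item "route-Schanuel-GelfondTowers"]
def Assembly : Prop :=
  RealGelfondSchneider → ThirdTowerAllBases → TranscendentalStep → GelfondRealTowers

end Summit.Schanuel.Schanuel.Theses.GelfondTowers
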